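import Mathlib
import Summits.Schanuel.Schanuel.Theses.RigidCore
import Literature.Barriers.Schanuel.LargeTranscendenceDegree
import Literature.NumberTheory.Transcendental.KirbyEDerivations
import Literature.NumberTheory.Transcendental.KirbyRelativeSchanuel

/-!
# Sketch — crux-ideate stmt-Schanuel-0970 (SchanuelOnLogFreeCore), ideator 3, round 1

First lemmas of the two idea cards, stated over existing declarations (elaboration only).
* Card `kernel-tower-relative-lw`   : the e/a-tower of the log-free core, the relative
  Lindemann–Weierstrass layers `RelLWZero`, `RelLWStep`, the reduction `TowerReduction`, and the
  unconditional Hankel base `HankelQuarter` (Diaz Thm 2.7 + a transcendence measure for `π`).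
* Card `generic-period-fibre`       : the kernel-free core `M = ℚ^{EA}`, the relative statement
  `PeriodGenericOverM`, the decomposition `HorizontalSplit`, and the two provable calibration
  lemmas `NoHiddenConstants`, `GenericFibre`.
-/

noncomputable section

open Complex IntermediateField

namespace Summit.Schanuel.Schanuel.Cruxes.SchanuelOnLogFreeCore.Ideator3

/-- The kernel generator `τ = 2πi`. -/
abbrev τ : ℂ := 2 * (Real.pi : ℂ) * Complex.I

/-- `exp`-closed and relatively algebraically closed intermediate fields of `ℂ/ℚ`. -/
def IsEAClosed (K : IntermediateField ℚ ℂ) : Prop :=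
  (∀ w ∈ K, Complex.exp w ∈ K) ∧ ∀ w : ℂ, IsAlgebraic K w → w ∈ K

/-- The log-free core `C_EA` (verbatim the set-builder inlined in the route decl). -/
def logFreeCore : IntermediateField ℚ ℂ :=
  sInf {K : IntermediateField ℚ ℂ | (2 * ↑Real.pi * Complex.I : ℂ) ∈ K ∧
    (∀ w ∈ K, Complex.exp w ∈ K) ∧ ∀ w : ℂ, IsAlgebraic K w → w ∈ K}

/-- The EA-closure of `ℚ(ω)` inside `ℂ` (the fibre of the `ω`-family; `logFreeCore` is the
fibre at `ω = 2πi`). -/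
def eaClosure (ω : ℂ) : IntermediateField ℚ ℂ :=
  sInf {K : IntermediateField ℚ ℂ | ω ∈ K ∧ (∀ w ∈ K, Complex.exp w ∈ K) ∧
    ∀ w : ℂ, IsAlgebraic K w → w ∈ K}

/-- The kernel-free core `M = ℚ^{EA} ∩ ℂ`: smallest `exp`-closed, relatively algebraically
closed subfield of `ℂ` (Macintyre–Wilkie sector; no period adjoined). -/
def kernelFreeCore : IntermediateField ℚ ℂ :=
  sInf {K : IntermediateField ℚ ℂ | (∀ w ∈ K, Complex.exp w ∈ K) ∧
    ∀ w : ℂ, IsAlgebraic K w → w ∈ K}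

/-- Schanuel's statement for `ℚ`-linearly independent tuples drawn from a subfield `K`. -/
def SchanuelOn (K : IntermediateField ℚ ℂ) : Prop :=
  ∀ (n : ℕ) (x : Fin n → ℂ), (∀ i, x i ∈ K) → LinearIndependent ℚ x →
    (n : Cardinal) ≤ Algebra.trdeg ℚ
      ↥(IntermediateField.adjoin ℚ (Set.range x ∪ Set.range (Complex.exp ∘ x)))

/-! ## Card 1 — kernel tower and relative Lindemann–Weierstrass -/

/-- Relative algebraic closure of an intermediate field `K` inside `ℂ`, as an intermediate
field over `ℚ`. -/
def relAlgClosure (K : IntermediateField ℚ ℂ) : IntermediateField ℚ ℂ :=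
  (algebraicClosure (↥K) ℂ).restrictScalars ℚ

/-- Level `0` of the tower: `L₀ = \overline{ℚ(2πi)} ∩ ℂ = \overline{ℚ(π)}`. -/
def towerZero : IntermediateField ℚ ℂ :=
  relAlgClosure (IntermediateField.adjoin ℚ {τ})

/-- The e/a-tower of the log-free core (Kirby FPEF Construction 2.9 read inside `ℂ`):
`L₀ = \overline{ℚ(2πi)}`, `L_{m+1} = \overline{L_m(e^{L_m})}` (relative algebraic closures in `ℂ`). -/
def tower : ℕ → IntermediateField ℚ ℂ
  | 0 => towerZero
  | m + 1 => relAlgClosure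
      (IntermediateField.adjoin ℚ ((tower m : Set ℂ) ∪ Complex.exp '' (tower m : Set ℂ)))

/-- `RelLW₀` — Lindemann–Weierstrass over `\overline{ℚ(π)}` modulo the kernel: exponentials of
elements of `L₀` that are `ℚ`-linearly independent modulo `ℚ·2πi` are algebraically independent
over `L₀`. Contains `e ⊥ π`, `e^{π²} ∉ ℚ̄`, Nesterenko's `π ⊥ e^{π√d}`, the Hankel family. -/
def RelLWZero : Prop :=
  ∀ (r : ℕ) (u : Fin r → ℂ), (∀ i, u i ∈ towerZero) →
    LinearIndependent ℚ ((Submodule.span ℚ ({τ} : Set ℂ)).mkQ ∘ u) →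
      AlgebraicIndependent (↥towerZero) (fun i => Complex.exp (u i))

/-- `RelLW_{m+1}` (heredity) — exponentials of elements of `L_{m+1}` that are `ℚ`-linearly
independent modulo `L_m` are algebraically independent over `L_{m+1}` ("exp of a generic point of
the previous layer stays generic"). -/
def RelLWStep : Prop :=
  ∀ (m r : ℕ) (u : Fin r → ℂ), (∀ i, u i ∈ tower (m + 1)) →
    LinearIndependent ℚ ((Submodule.span ℚ (tower m : Set ℂ)).mkQ ∘ u) →
      AlgebraicIndependent (↥(tower (m + 1))) (fun i => Complex.exp (u i))

/-- The tower exhausts the log-free core (bookkeeping, provable now). -/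
def TowerExhausts : Prop :=
  (logFreeCore : Set ℂ) = ⋃ m, (tower m : Set ℂ)

/-- CARD 1 REDUCTION (composition of the skeleton): the two relative-LW layers give the crux. -/
def TowerReduction : Prop :=
  RelLWZero → RelLWStep → Summit.Schanuel.Schanuel.Theses.RigidCore.SchanuelOnLogFreeCore

/-- Powers `1, τ, …, τ^{d-1}` of the kernel generator: the canonical symmetric grid of `L₀`. -/
def τpow (d : ℕ) : Fin d → ℂ := fun i => τ ^ (i : ℕ)

/-- Technical Hypothesis for the powers of `2πi` (dischargeable from Fel'dman's / Mahler's
transcendence measure `|P(π)| ≥ H^{-c(d)}`, via `TechnicalHypothesis.of_lowerBound`). -/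
def PiPowersTH : Prop :=
  ∀ d : ℕ, Literature.Barriers.Schanuel.TechnicalHypothesis (τpow d)

/-- HANKEL QUARTER (unconditional modulo the two named facts): among
`π, e, e^{τ²}, e^{τ³}, …, e^{τ^{2d-2}}` (`τ = 2πi`, `e^{τ} = 1`) at least `⌈d/2⌉` are algebraically
independent; `RelLW₀` predicts `2d - 1`. -/
def HankelQuarter : Prop :=
  ∀ d : ℕ, 3 ≤ d →
    ((⌈((d * d : ℕ) : ℚ) / ((d + d : ℕ) : ℚ)⌉₊ : ℕ) : Cardinal) ≤
      Algebra.trdeg ℚ ↥(Literature.Barriers.Schanuel.gridField₂ (τpow d) (τpow d))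

/-- CARD 1 FIRST LEMMA: Diaz's Theorem 2.7 on the symmetric kernel grid. -/
def FirstLemmaCard1 : Prop :=
  Literature.Barriers.Schanuel.LargeTranscendenceDegree → PiPowersTH → HankelQuarter

/-! ## Card 2 — the generic-period fibre -/

/-- `Rel_M` — THE PERIOD IS GENERIC OVER THE KERNEL-FREE CORE: relative Schanuel of the log-free
core over `M` (shape of `kirby_relative_schanuel_complex` with `ecl ∅ ↦ M`, domain `C_EA`). -/
def PeriodGenericOverM : Prop :=
  ∀ (n : ℕ) (x : Fin n → ℂ), (∀ i, x i ∈ logFreeCore) →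
    LinearIndependent ℚ ((Submodule.span ℚ (kernelFreeCore : Set ℂ)).mkQ ∘ x) →
      (n : Cardinal) ≤ Algebra.trdeg ↥kernelFreeCore
        ↥(IntermediateField.adjoin ↥kernelFreeCore (Set.range x ∪ Set.range (Complex.exp ∘ x)))

/-- CARD 2 DECOMPOSITION (composition of the skeleton): Macintyre's kernel-free Schanuel plus
genericity of the period over `M` give the crux. -/
def HorizontalSplit : Prop :=
  SchanuelOn kernelFreeCore → PeriodGenericOverM →
    Summit.Schanuel.Schanuel.Theses.RigidCore.SchanuelOnLogFreeCore

/-- NO HIDDEN CONSTANTS (provable now: E-derivations + identity principle): for `ω` outside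
Kirby's derivation closure `dcl ∅` (`= ecl ∅` by Kirby Thm 1.1), every element of the fibre
`ℚ(ω)^{EA}` that is exponentially algebraic already lies in the kernel-free core `M`. -/
def NoHiddenConstants : Prop :=
  ∀ ω : ℂ, ω ∉ Literature.NumberTheory.Transcendental.dcl (∅ : Set ℂ) →
    (eaClosure ω : Set ℂ) ∩ Literature.NumberTheory.Transcendental.dcl (∅ : Set ℂ) ⊆ (kernelFreeCore : Set ℂ)

/-- The generic analogue of `Rel_M`, with the fibre `ℚ(ω)^{EA}` in place of `C_EA`. -/
def GenericRelOverM (ω : ℂ) : Prop :=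
  ∀ (n : ℕ) (x : Fin n → ℂ), (∀ i, x i ∈ eaClosure ω) →
    LinearIndependent ℚ ((Submodule.span ℚ (kernelFreeCore : Set ℂ)).mkQ ∘ x) →
      (n : Cardinal) ≤ Algebra.trdeg ↥kernelFreeCore
        ↥(IntermediateField.adjoin ↥kernelFreeCore (Set.range x ∪ Set.range (Complex.exp ∘ x)))

/-- CARD 2 FIRST LEMMA — GENERIC FIBRE THEOREM (provable now from the PROVED tree fact
`kirby_relative_schanuel_complex` + `NoHiddenConstants` + `ecl_subset_dcl`): at a generic period
the relative statement is a theorem, and Schanuel on the fibre reduces to Schanuel on `M`. -/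
def GenericFibre : Prop :=
  ∀ ω : ℂ, ω ∉ Literature.NumberTheory.Transcendental.dcl (∅ : Set ℂ) →
    GenericRelOverM ω ∧ (SchanuelOn kernelFreeCore → SchanuelOn (eaClosure ω))

/-- The tree fact the generic fibre leans on (PROVED: `kirby_relative_schanuel_complex_holds`). -/
example : Prop := Literature.NumberTheory.Transcendental.kirby_relative_schanuel_complex

/-- Sanity: the route decl is Schanuel on the log-free core as defined here (definitional). -/
example : SchanuelOn logFreeCore ↔
    Summit.Schanuel.Schanuel.Theses.RigidCore.SchanuelOnLogFreeCore := Iff.rfl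

end Summit.Schanuel.Schanuel.Cruxes.SchanuelOnLogFreeCore.Ideator3

end
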